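import Mathlib.RingTheory.Extension.Presentation.Submersive
import Mathlib.LinearAlgebra.Matrix.NonsingularInverse
import Mathlib.LinearAlgebra.Multilinear.Basic
import HarnessLib

/-!
# Twisted point derivations on a standard smooth algebra: chain rule and implicit coefficients

Let `S` be an `R₀`-algebra with a SUBMERSIVE PRESENTATION `P` (Mathlib
`Algebra.SubmersivePresentation`: generators `xᵢ = P.val i`, `i ∈ ι`, relations `fⱼ`, `j ∈ σ`,
distinguished variables `x_{P.map j}` with invertible Jacobian `det (∂fⱼ/∂x_{P.map i})`), let
`χ : S →+* L` be a ring homomorphism ("evaluation at a point") and `D : S → W` a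
**`χ`-twisted derivation** into an `L`-module: additive, `D(ab) = χ(a) D(b) + χ(b) D(a)`, and
killing `R₀`. Examples: the differential at a point `y` of regular functions read on an
analytification (`χ = ev_y`), and the same composed with the `σ`-semilinear ring isomorphism
`Γ(Y, 𝒪) ≅ Γ(Y^σ, 𝒪)` of a conjugate variety (`χ = σ ∘ ev_y`), which is NOT a `ℂ`-linear
derivation — whence the twisted, `R₀`-free formulation.

* `IsTwistedDerivation.apply_aeval` — the chain rule `D(p(x)) = ∑ᵢ χ(∂ᵢp(x)) D(xᵢ)`;
* `implicitCoeff P s i ∈ S` (`i` a FREE index, `i ∉ range P.map`) — the implicit-function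
  coefficients, defined algebraically in `S` from the inverse Jacobian, and
  `IsTwistedDerivation.apply_eq_sum_implicitCoeff`: `D(s) = ∑_{i free} χ(implicitCoeff P s i) D(xᵢ)`
  for EVERY twisted derivation `(χ, D)` — the distinguished `D(x_{P.map j})` are eliminated through
  the relations `D(fⱼ(x)) = 0`;
* `IsTwistedDerivation.sum_smul_multilinear_eq` — consequently a "form expression"
  `∑ⱼ χ(cⱼ) Θ(D g_{j,0}, …, D g_{j,n-1})` (`Θ` any `L`-multilinear map) equals
  `∑_I χ(b_I) Θ(D x_{I(0)}, …, D x_{I(n-1)})` over all maps `I : Fin n → free indices`, with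
  coefficients `b_I ∈ S` INDEPENDENT of `(χ, D, Θ)`.

This is the elementary algebra of "local algebraic coordinates" (Serre, GAGA §1 n°4; SGA 1 II) in
the form needed to compare the realisations of an algebraic differential form on a smooth affine
variety and on its conjugates.

## References

* J.-P. Serre, *Géométrie algébrique et géométrie analytique*, Ann. Inst. Fourier 6 (1956), §1 n°4.
* A. Grothendieck, M. Raynaud, *SGA 1*, Exp. II (morphismes lisses: coordonnées locales).
-/

noncomputable section

open MvPolynomial

namespace Literature.RingTheory.Derivation

section Twisted

variable {R₀ S L W : Type*} [CommRing R₀] [CommRing S] [Algebra R₀ S] [CommRing L]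
  [AddCommGroup W] [Module L W]

variable (R₀) in
/-- A **`χ`-twisted point derivation** of the `R₀`-algebra `S` into the `L`-module `W` along the
ring homomorphism `χ : S →+* L`: an additive map with the Leibniz rule
`D(ab) = χ(a) D(b) + χ(b) D(a)` vanishing on `R₀` (e.g. `D = δ ∘ ψ` for a point derivation `δ`
and a ring isomorphism `ψ` semilinear over the base). [folklore] -/
structure IsTwistedDerivation (χ : S →+* L) (D : S → W) : Prop where
  /-- Additivity. -/
  additive : ∀ x y, D (x + y) = D x + D y
  /-- The twisted Leibniz rule. -/
  leibniz : ∀ x y, D (x * y) = χ x • D y + χ y • D x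
  /-- Constants are killed. -/
  apply_algebraMap : ∀ r : R₀, D (algebraMap R₀ S r) = 0

namespace IsTwistedDerivation

variable {χ : S →+* L} {D : S → W}

/-- A twisted derivation kills `0`. [folklore] -/
theorem apply_zero (hD : IsTwistedDerivation R₀ χ D) : D 0 = 0 := by
  simpa using hD.apply_algebraMap 0

/-- A twisted derivation kills `1`. [folklore] -/
theorem apply_one (hD : IsTwistedDerivation R₀ χ D) : D 1 = 0 := by
  simpa using hD.apply_algebraMap 1

/-- A twisted derivation is additive over finite sums. [folklore] -/
theorem apply_sum (hD : IsTwistedDerivation R₀ χ D) {α : Type*} (s : Finset α) (g : α → S) :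
    D (∑ a ∈ s, g a) = ∑ a ∈ s, D (g a) := by
  classical
  induction s using Finset.induction_on with
  | empty => simp [hD.apply_zero]
  | insert a s ha ih => rw [Finset.sum_insert ha, Finset.sum_insert ha, hD.additive, ih]

/-- **Chain rule** for a twisted derivation: `D(p(x)) = ∑ᵢ χ((∂ᵢ p)(x)) • D(xᵢ)` for every
polynomial `p` with coefficients in `R₀` (induction on `p`). [folklore] -/
theorem apply_aeval (hD : IsTwistedDerivation R₀ χ D) {ι : Type*} [Fintype ι] [DecidableEq ι]
    (val : ι → S) (p : MvPolynomial ι R₀) :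
    D (aeval val p) = ∑ i, χ (aeval val (pderiv i p)) • D (val i) := by
  induction p using MvPolynomial.induction_on with
  | C r =>
    rw [MvPolynomial.aeval_C, hD.apply_algebraMap]
    symm
    exact Finset.sum_eq_zero fun k _ ↦ by
      rw [pderiv_C, _root_.map_zero, _root_.map_zero, zero_smul]
  | add p q hp hq =>
    rw [_root_.map_add, hD.additive, hp, hq, ← Finset.sum_add_distrib]
    exact Finset.sum_congr rfl fun k _ ↦ by
      rw [_root_.map_add, _root_.map_add, _root_.map_add, add_smul]
  | mul_X p i hp =>
    rw [_root_.map_mul, aeval_X, hD.leibniz, hp, Finset.smul_sum]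
    have hk : ∀ k, χ (aeval val (pderiv k (p * X i))) • D (val k) =
        χ (val i) • (χ (aeval val (pderiv k p)) • D (val k)) +
          (if k = i then χ (aeval val p) • D (val i) else 0) := by
      intro k
      rw [pderiv_mul, pderiv_X, Pi.single_apply, _root_.map_add, _root_.map_mul, aeval_X,
        _root_.map_add, _root_.map_mul, add_smul, mul_comm (χ (aeval val (pderiv k p))), mul_smul]
      congr 1
      by_cases hki : k = i
      · subst hki
        rw [if_pos rfl, if_pos rfl, mul_one]
      · rw [if_neg (Ne.symm hki), if_neg hki, mul_zero, _root_.map_zero, _root_.map_zero, zero_smul]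
    simp only [hk, Finset.sum_add_distrib, Finset.sum_ite_eq', Finset.mem_univ, if_true]
    rw [add_comm]

end IsTwistedDerivation

/-- Matrix form of "an invertible matrix kills only the zero vector", for MODULE-valued vectors:
if `det M` is a unit and `∑ₐ M a j • x a = 0` for all `j`, then `x = 0`. [folklore] -/
theorem eq_zero_of_forall_sum_smul_eq_zero {σ : Type*} [Fintype σ] [DecidableEq σ]
    {M : Matrix σ σ L} (hM : IsUnit M.det) (x : σ → W) (h : ∀ j, ∑ a, M a j • x a = 0) :
    x = 0 := by
  have hMt : IsUnit M.transpose.det := by rwa [Matrix.det_transpose]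
  set N : Matrix σ σ L := M.transpose⁻¹ with hN
  have hNM : N * M.transpose = 1 := Matrix.nonsing_inv_mul _ hMt
  funext b
  have hb : x b = ∑ a, (N * M.transpose) b a • x a := by
    rw [hNM]
    simp [Matrix.one_apply, ite_smul, Finset.sum_ite_eq]
  rw [hb]
  calc ∑ a, (N * M.transpose) b a • x a
      = ∑ a, ∑ j, (N b j * M a j) • x a := by
        refine Finset.sum_congr rfl fun a _ ↦ ?_
        rw [Matrix.mul_apply, Finset.sum_smul]
        rfl
    _ = ∑ j, N b j • ∑ a, M a j • x a := by
        rw [Finset.sum_comm]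
        refine Finset.sum_congr rfl fun j _ ↦ ?_
        rw [Finset.smul_sum]
        exact Finset.sum_congr rfl fun a _ ↦ by rw [mul_smul]
    _ = 0 := by simp [h]

end Twisted

/-! ### Implicit coefficients on a submersive presentation -/

section Submersive

variable {R₀ S : Type*} [CommRing R₀] [CommRing S] [Algebra R₀ S]
  {ι σ : Type*} [Fintype ι] [Fintype σ] [DecidableEq ι] [DecidableEq σ]
  (P : Algebra.SubmersivePresentation R₀ S ι σ)

/-- The FREE indices of a submersive presentation: the variables that are not distinguished
(`i ∉ range P.map`); there are `dim S` of them. [folklore] -/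
abbrev Free : Type _ := {i : ι // i ∉ Set.range P.map}

/-- The Jacobian matrix `(∂fⱼ/∂x_{P.map a})(x) ∈ S` of the relations in the distinguished
variables (rows `a`, columns `j`; the matrix of Mathlib's `aevalDifferential`). [folklore] -/
def jacMat : Matrix σ σ S :=
  LinearMap.toMatrix' P.toPreSubmersivePresentation.aevalDifferential

omit [Fintype ι] [DecidableEq ι] in
/-- Entries of the Jacobian matrix. [folklore] -/
theorem jacMat_apply (a j : σ) :
    jacMat P a j = aeval P.val (pderiv (P.map a) (P.relation j)) := by
  rw [jacMat, LinearMap.toMatrix'_apply, Algebra.PreSubmersivePresentation.aevalDifferential_single]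

omit [Fintype ι] [DecidableEq ι] in
/-- The Jacobian matrix of a submersive presentation has unit determinant. [folklore] -/
theorem isUnit_det_jacMat : IsUnit (jacMat P).det := by
  rw [jacMat, LinearMap.det_toMatrix', ← Algebra.PreSubmersivePresentation.jacobian_eq_det_aevalDifferential]
  exact P.jacobian_isUnit

/-- The matrix `B = -(Jᵀ)⁻¹ · (∂fⱼ/∂xᵢ)_{j, i free}` expressing, to first order, the distinguished
variables through the free ones: `∑ₐ J a j · B a i = -∂fⱼ/∂xᵢ` (`jacMat_mul_implicitMat`).
[folklore] -/
def implicitMat : Matrix σ (Free P) S :=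
  -((jacMat P).transpose⁻¹ * Matrix.of fun j (i : Free P) ↦ aeval P.val (pderiv i.1 (P.relation j)))

omit [Fintype ι] [DecidableEq ι] in
/-- The defining identity of `implicitMat`: `∑ₐ (∂fⱼ/∂x_{P.map a}) · B a i = -∂fⱼ/∂xᵢ`. [folklore] -/
theorem jacMat_mul_implicitMat (j : σ) (i : Free P) :
    ∑ a, jacMat P a j * implicitMat P a i = -aeval P.val (pderiv i.1 (P.relation j)) := by
  have hMt : IsUnit (jacMat P).transpose.det := by
    rw [Matrix.det_transpose]; exact isUnit_det_jacMat P
  have key : ((jacMat P).transpose * ((jacMat P).transpose⁻¹ *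
      Matrix.of fun j (i : Free P) ↦ aeval P.val (pderiv i.1 (P.relation j)))) j i =
        aeval P.val (pderiv i.1 (P.relation j)) := by
    rw [← Matrix.mul_assoc, Matrix.mul_nonsing_inv _ hMt, Matrix.one_mul, Matrix.of_apply]
  rw [← key, Matrix.mul_apply, ← Finset.sum_neg_distrib]
  refine Finset.sum_congr rfl fun a _ ↦ ?_
  rw [implicitMat, Matrix.neg_apply, mul_neg, Matrix.transpose_apply]

/-- The **implicit coefficients** of `s ∈ S` along the free variables: with `p = P.σ s` a
polynomial lift of `s`, `implicitCoeff P s i = ∂ᵢp(x) + ∑ₐ ∂_{P.map a} p(x) · B a i` — the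
coefficient of `dxᵢ` when the `dx_{P.map a}` are eliminated through the relations. [folklore] -/
def implicitCoeff (s : S) (i : Free P) : S :=
  aeval P.val (pderiv i.1 (P.σ s)) + ∑ a, aeval P.val (pderiv (P.map a) (P.σ s)) * implicitMat P a i

omit [DecidableEq σ] in
/-- Splitting a sum over all variables into distinguished and free ones. [folklore] -/
theorem sum_eq_sum_map_add_sum_free {β : Type*} [AddCommMonoid β] (g : ι → β) :
    ∑ k, g k = ∑ a, g (P.map a) + ∑ i : Free P, g i.1 := by
  classical
  have h1 : (Finset.univ.filter fun k ↦ k ∈ Set.range P.map) = Finset.univ.image P.map := by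
    ext k
    simp
  rw [← Finset.sum_filter_add_sum_filter_not Finset.univ (fun k ↦ k ∈ Set.range P.map), h1,
    Finset.sum_image fun a _ b _ h ↦ P.map_inj h]
  congr 1
  exact Finset.sum_subtype _ (fun k ↦ by simp) g

variable {L W : Type*} [CommRing L] [AddCommGroup W] [Module L W] {χ : S →+* L} {D : S → W}

/-- **Elimination of the distinguished differentials.** For every `χ`-twisted derivation `D`,
`D(s) = ∑_{i free} χ(implicitCoeff P s i) • D(xᵢ)`: the relations give
`∑ₐ χ(J a j) D(x_{P.map a}) = -∑_{i free} χ(∂fⱼ/∂xᵢ) D(xᵢ)`, the matrix `χ(J)` is invertible over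
`L`, and the chain rule does the rest. [folklore] -/
theorem IsTwistedDerivation.apply_eq_sum_implicitCoeff (hD : IsTwistedDerivation R₀ χ D) (s : S) :
    D s = ∑ i : Free P, χ (implicitCoeff P s i) • D (P.val i.1) := by
  classical
  -- the candidate expression of the distinguished differentials through the free ones
  set d' : σ → W := fun a ↦ ∑ i : Free P, χ (implicitMat P a i) • D (P.val i.1) with hd'
  -- the relations, differentiated
  have hrel : ∀ j, ∑ a, χ (jacMat P a j) • D (P.val (P.map a)) +
      ∑ i : Free P, χ (aeval P.val (pderiv i.1 (P.relation j))) • D (P.val i.1) = 0 := by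
    intro j
    have h0 : D (aeval P.val (P.relation j)) = 0 := by
      rw [P.aeval_val_relation, hD.apply_zero]
    rw [hD.apply_aeval, sum_eq_sum_map_add_sum_free P] at h0
    simpa only [jacMat_apply] using h0
  have hrel' : ∀ j, ∑ a, χ (jacMat P a j) • d' a =
      -∑ i : Free P, χ (aeval P.val (pderiv i.1 (P.relation j))) • D (P.val i.1) := by
    intro j
    have ha : ∀ a, χ (jacMat P a j) • d' a =
        ∑ i : Free P, χ (jacMat P a j * implicitMat P a i) • D (P.val i.1) := by
      intro a
      rw [hd', Finset.smul_sum]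
      exact Finset.sum_congr rfl fun i _ ↦ by rw [smul_smul, ← _root_.map_mul]
    rw [Finset.sum_congr rfl fun a _ ↦ ha a, Finset.sum_comm, ← Finset.sum_neg_distrib]
    refine Finset.sum_congr rfl fun i _ ↦ ?_
    rw [← Finset.sum_smul, ← _root_.map_sum, jacMat_mul_implicitMat, _root_.map_neg, neg_smul]
  -- hence the distinguished differentials ARE given by `d'`
  have hU : IsUnit ((χ.mapMatrix : Matrix σ σ S →+* Matrix σ σ L) (jacMat P)).det := by
    rw [← RingHom.map_det]
    exact (isUnit_det_jacMat P).map χ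
  have hd : (fun a ↦ D (P.val (P.map a))) - d' = 0 := by
    refine eq_zero_of_forall_sum_smul_eq_zero hU _ fun j ↦ ?_
    have h1 := hrel j
    simp only [RingHom.mapMatrix_apply, Matrix.map_apply, Pi.sub_apply, smul_sub,
      Finset.sum_sub_distrib, hrel' j, sub_neg_eq_add]
    exact h1
  have hd1 : ∀ a, D (P.val (P.map a)) = d' a := fun a ↦
    sub_eq_zero.1 (congrFun hd a)
  -- chain rule for a lift of `s`
  conv_lhs => rw [← P.aeval_val_σ s, hD.apply_aeval, sum_eq_sum_map_add_sum_free P]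
  have hR : ∀ i : Free P, χ (implicitCoeff P s i) • D (P.val i.1) =
      χ (aeval P.val (pderiv i.1 (P.σ s))) • D (P.val i.1) +
        ∑ a, χ (aeval P.val (pderiv (P.map a) (P.σ s)) * implicitMat P a i) • D (P.val i.1) := by
    intro i
    rw [implicitCoeff, _root_.map_add, add_smul, _root_.map_sum, Finset.sum_smul]
  have hL : ∀ a, χ (aeval P.val (pderiv (P.map a) (P.σ s))) • D (P.val (P.map a)) =
      ∑ i : Free P, χ (aeval P.val (pderiv (P.map a) (P.σ s)) * implicitMat P a i) •
        D (P.val i.1) := by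
    intro a
    rw [hd1 a, hd', Finset.smul_sum]
    exact Finset.sum_congr rfl fun i _ ↦ by rw [smul_smul, ← _root_.map_mul]
  rw [Finset.sum_congr rfl fun i _ ↦ hR i, Finset.sum_congr rfl fun a _ ↦ hL a,
    Finset.sum_add_distrib, Finset.sum_comm, add_comm]

/-- **Readout of a form expression in the free differentials.** For an `L`-multilinear `Θ`,
`∑ⱼ χ(cⱼ) Θ(D g_{j,0}, …, D g_{j,n-1}) = ∑_{I} χ(b_I) Θ(D x_{I(0)}, …, D x_{I(n-1)})`, the sum
over ALL maps `I` from `Fin n` to the free indices, with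
`b_I = ∑ⱼ cⱼ ∏ₗ implicitCoeff P g_{j,l} (I l) ∈ S` independent of `χ`, `D`, `Θ`. [folklore] -/
theorem IsTwistedDerivation.sum_smul_multilinear_eq (hD : IsTwistedDerivation R₀ χ D) {n N : ℕ}
    {G : Type*} [AddCommGroup G] [Module L G] (Θ : MultilinearMap L (fun _ : Fin n ↦ W) G)
    (coef : Fin N → S) (arg : Fin N → Fin n → S) :
    ∑ j, χ (coef j) • Θ (fun l ↦ D (arg j l)) =
      ∑ I : Fin n → Free P, χ (∑ j, coef j * ∏ l, implicitCoeff P (arg j l) (I l)) •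
        Θ (fun l ↦ D (P.val (I l).1)) := by
  classical
  have hΘ : ∀ j, Θ (fun l ↦ D (arg j l)) =
      ∑ I : Fin n → Free P, (∏ l, χ (implicitCoeff P (arg j l) (I l))) •
        Θ (fun l ↦ D (P.val (I l).1)) := by
    intro j
    have h1 : (fun l ↦ D (arg j l)) =
        fun l ↦ ∑ i : Free P, χ (implicitCoeff P (arg j l) i) • D (P.val i.1) :=
      funext fun l ↦ hD.apply_eq_sum_implicitCoeff P (arg j l)
    rw [h1, MultilinearMap.map_sum Θ
      (fun l (i : Free P) ↦ χ (implicitCoeff P (arg j l) i) • D (P.val i.1))]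
    exact Finset.sum_congr rfl fun I _ ↦ by rw [MultilinearMap.map_smul_univ]
  have hj : ∀ j, χ (coef j) • Θ (fun l ↦ D (arg j l)) =
      ∑ I : Fin n → Free P, χ (coef j * ∏ l, implicitCoeff P (arg j l) (I l)) •
        Θ (fun l ↦ D (P.val (I l).1)) := by
    intro j
    rw [hΘ j, Finset.smul_sum]
    exact Finset.sum_congr rfl fun I _ ↦ by rw [smul_smul, _root_.map_mul, _root_.map_prod]
  rw [Finset.sum_congr rfl fun j _ ↦ hj j, Finset.sum_comm]
  exact Finset.sum_congr rfl fun I _ ↦ by rw [← Finset.sum_smul, ← _root_.map_sum]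

end Submersive

end Literature.RingTheory.Derivation

end
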